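import Literature.Probability.RandomPlanarGeometry.SAWBendingEnergyEndpoint
import Literature.Probability.RandomPlanarGeometry.SAWBendingBlockRenewal
import Literature.Probability.RandomPlanarGeometry.SAWPolygonsFromBridges
import HarnessLib

/-!
# All-turn re-rooting layer («L-POLY» K2a): step types, rotation of even all-turn bridge words, the
`(+e₁, ±e₂)` extension

Topic `Literature/Probability/RandomPlanarGeometry` (continues `SAWBendingEnergyEndpoint.lean` — the all-turn
words `allTurnWords M` — and `SAWPolygonsFromBridges.lean` — Madras–Slade's re-rooting `Zd.reroot`, Theorem 3.2.4).
Lane «pcv-sawmu», a-idea-2's `Sketch_v9_LPOLY.lean` (the all-turn / L-lattice Hammersley theorem): this file is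
the connector-independent layer of its crux K2 (`AllTurnPolygonsFromBridges`), for the K2 owner to build on:

* `Step.typ` (horizontal `0` / vertical `1`) and **`typ_getElem_of_mem_allTurnWords`**: along an all-turn
  self-avoiding word the types alternate, `typ w[i] ≡ typ w[0] + i (mod 2)`;
* `getElem_zero_of_isBridge` (a bridge word starts with `+e₁`) and **`typ_getLast_of_even`** (an all-turn bridge
  word of even length ends with a vertical letter — also the premise of S6 `AllTurnConcat`);
* **`traj_rotate`**: rotating the word by `i` IS the tree's re-rooting, `traj (w.rotate i) = Zd.reroot M i (traj w)`,
  and **`wturns_rotate_of_bridge`**: every rotation of an even all-turn bridge word is all-turn (the wrap junction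
  is vertical → `+e₁`);
* `isSAW_append_of_sep` (concatenation separated by a functional is self-avoiding) and the extension
  **`extendAT w = w · (+e₁) · (±e₂)`** (sign away from the `x`-axis): injective, all-turn, a bridge of length
  `M + 2`, endpoint off the `x`-axis (`extendAT_mem_allTurnWords`, `wEnd_extendAT_apply_one_ne_zero`).
[cite: MadrasSlade1993, §3.2 (proof of Theorem 3.2.4)]
-/

noncomputable section


namespace Literature.Probability.RandomPlanarGeometry.SAW

open Finset Literature.Probability.LatticeModels Literature.Probability.Percolation SimpleGraph

/-! ### All-turn words: consecutive letters differ (private copies; the public statements are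
`consec_ne_of_wturns_eq` / `wturns_eq_of_consec_ne` of `SAWBendingEnergyAllTurnWindow.lean`, a-p6) -/

/-- In an all-turn word all consecutive letters differ. [cite: MadrasSlade1993, §1.1] -/
private theorem consec_ne_of_allTurn : ∀ (w : List Step), wturns w = w.length - 1 →
    ∀ (i : ℕ) (h : i + 1 < w.length), w[i] ≠ w[i + 1]
  | [], _, i, h => by simp at h
  | [a], _, i, h => by simp at h
  | a :: b :: w, hw, i, h => by
    have hle := wturns_le_length_sub_one (b :: w)
    simp only [wturns_cons_cons, List.length_cons] at hw hle
    have hab : a ≠ b := by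
      by_contra hab
      rw [if_pos hab] at hw
      omega
    rw [if_neg hab] at hw
    rcases i with _ | i
    · simpa using hab
    · have ih := consec_ne_of_allTurn (b :: w) (by simp only [List.length_cons]; omega) i (by simpa using h)
      simpa using ih

/-- If all consecutive letters differ, the word is all-turn. [cite: MadrasSlade1993, §1.1] -/
private theorem allTurn_of_consec_ne : ∀ (w : List Step),
    (∀ (i : ℕ) (h : i + 1 < w.length), w[i] ≠ w[i + 1]) → wturns w = w.length - 1
  | [], _ => rfl
  | [a], _ => rfl
  | a :: b :: w, h => by
    have hab : a ≠ b := h 0 (by simp)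
    have ih := allTurn_of_consec_ne (b :: w) fun i hi => h (i + 1) (by simpa using hi)
    rw [wturns_cons_cons, if_neg hab, ih]
    simp only [List.length_cons]
    omega

/-! ### Step types: horizontal letters `0, 2`, vertical letters `1, 3` -/

/-- The type of a letter: `0` for the horizontal steps `±e₁` (letters `0, 2`), `1` for the vertical steps
`±e₂` (letters `1, 3`). [cite: MadrasSlade1993, §1.1] -/
def Step.typ (a : Step) : ℕ := a.val % 2

/-- A quarter turn changes the type. [cite: MadrasSlade1993, §1.1] -/
theorem Step.typ_add_one (a : Step) : (a + 1).typ = 1 - a.typ := by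
  revert a; decide

/-- A quarter turn (the other way) changes the type. [cite: MadrasSlade1993, §1.1] -/
theorem Step.typ_add_three (a : Step) : (a + 3).typ = 1 - a.typ := by
  revert a; decide

/-- `typ a ≤ 1`. [cite: MadrasSlade1993, §1.1 (step words; elementary bookkeeping)] -/
theorem Step.typ_le_one (a : Step) : a.typ ≤ 1 := by
  revert a; decide

/-- A letter that is neither `a` nor its opposite `a + 2` is a quarter turn of `a`, so has the other type.
[cite: MadrasSlade1993, §1.1] -/
theorem Step.typ_of_ne_of_ne_add_two {a b : Step} (h1 : b ≠ a) (h2 : b ≠ a + 2) : b.typ = 1 - a.typ := by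
  revert a b; decide

/-- A letter is vertical iff its step has first coordinate `0`. [cite: MadrasSlade1993, §1.1] -/
theorem Step.typ_eq_one_iff (a : Step) : a.typ = 1 ↔ Step.vec a 0 = 0 := by
  revert a; decide

/-- Letters of different type are different. [cite: MadrasSlade1993, §1.1 (step words; elementary bookkeeping)] -/
theorem Step.ne_of_typ_ne {a b : Step} (h : a.typ ≠ b.typ) : a ≠ b := fun hab => h (hab ▸ rfl)

/-- **Types alternate along an all-turn self-avoiding word**: `typ w[i] ≡ typ w[0] + i (mod 2)`.
[cite: MadrasSlade1993, §1.1] -/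
theorem typ_getElem_of_mem_allTurnWords {M : ℕ} {w : List Step} (hw : w ∈ allTurnWords M) :
    ∀ (i : ℕ) (hi : i < w.length), (w[i]).typ = ((w[0]'(by omega)).typ + i) % 2 := by
  obtain ⟨hl, hs, ht⟩ := mem_allTurnWords.1 hw
  have hall := consec_ne_of_allTurn w (by rw [hl]; exact ht)
  intro i
  induction i with
  | zero => intro hi; have := Step.typ_le_one (w[0]'hi); simp; omega
  | succ i ih =>
    intro hi
    have h0 := ih (by omega)
    have ht0 := Step.typ_le_one (w[0]'(by omega))
    have h1 : w[i + 1] ≠ w[i] := (hall i hi).symm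
    have h2 : w[i + 1] ≠ w[i] + 2 := by
      have e : w = w.take i ++ w[i] :: w[i + 1] :: w.drop (i + 2) := by
        conv_lhs => rw [← List.take_append_drop i w, List.drop_eq_getElem_cons (by omega : i < w.length),
          List.drop_eq_getElem_cons (by omega : i + 1 < w.length)]
      have hs' := hs
      rw [e] at hs'
      exact IsSAW.ne_add_two hs'
    rw [Step.typ_of_ne_of_ne_add_two h1 h2, h0]
    have := Step.typ_le_one w[i]
    omega

/-! ### All-turn bridge words -/

/-- The first letter of (the word of) a bridge is `+e₁` (letter `0`): `0 = ω₁(0) < ω₁(1)`.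
[cite: MadrasSlade1993, Definition 1.2.4] -/
theorem getElem_zero_of_isBridge {w : List Step} (hw : 0 < w.length) (hb : Zd.IsBridge w.length (traj w)) :
    w[0] = 0 := by
  have h1 := (hb 1 le_rfl (by omega)).1
  rw [traj_zero, traj_succ w hw, traj_zero, zero_add] at h1
  simp only [Pi.zero_apply] at h1
  generalize w[0] = a at h1
  revert h1 a; decide

/-- An all-turn bridge word of EVEN positive length ends with a vertical letter. [cite: MadrasSlade1993, §1.1 and Definition 1.2.4] -/
theorem typ_getLast_of_even {M : ℕ} {w : List Step} (hw : w ∈ allTurnWords M) (hM : 0 < M) (hev : Even M)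
    (hb : Zd.IsBridge M (traj w)) : (w[M - 1]'(by rw [(mem_allTurnWords.1 hw).1]; omega)).typ = 1 := by
  have hl := (mem_allTurnWords.1 hw).1
  have h0 : w[0]'(by omega) = 0 := getElem_zero_of_isBridge (by omega) (hl.symm ▸ hb)
  rw [typ_getElem_of_mem_allTurnWords hw (M - 1) (by omega), h0]
  obtain ⟨m, rfl⟩ := hev
  show (Step.typ 0 + (m + m - 1)) % 2 = 1
  simp only [Step.typ, Fin.val_zero, Nat.zero_mod, zero_add]
  omega

/-! ### Rotation = re-rooting -/

/-- The endpoint of a word is invariant under rotation. [cite: MadrasSlade1993, §1.1 (step words; elementary bookkeeping)] -/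
theorem wEnd_rotate (w : List Step) (i : ℕ) : wEnd (w.rotate i) = wEnd w := by
  unfold wEnd
  rw [List.map_rotate]
  exact (List.rotate_perm _ _).sum_eq

/-- **Rotating the word re-roots the walk**: `traj (w.rotate i) = reroot M i (traj w)` (`|w| = M`, `i ≤ M`).
[cite: MadrasSlade1993, §3.2 (proof of Theorem 3.2.4, the walk `ω̄`)] -/
theorem traj_rotate {M i : ℕ} {w : List Step} (hl : w.length = M) (hi : i ≤ M) :
    traj (w.rotate i) = Zd.reroot M i (traj w) := by
  funext k
  have hrot : w.rotate i = w.drop i ++ w.take i := by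
    rcases hi.lt_or_eq with h | h
    · exact List.rotate_eq_drop_append_take (by omega)
    · subst h; rw [← hl, List.rotate_length, List.drop_length, List.take_length, List.nil_append]
  have hdl : (w.drop i).length = M - i := by simp [hl]
  have hsplit : ∀ j, traj (w.drop i) j = traj w (i + j) - traj w i := by
    intro j
    simp only [traj]
    rw [List.take_add, wEnd_append]
    abel
  have hE : wEnd (w.drop i) = traj w M - traj w i := by
    rw [← traj_length (w.drop i), hdl, hsplit, show i + (M - i) = M by omega]
  rcases le_or_gt k M with hk | hk
  · rw [Zd.reroot_of_le hk, hrot]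
    rcases le_or_gt k (M - i) with hki | hki
    · rw [traj_append_left _ _ (by omega), Zd.rerootRaw_of_le (by omega), hsplit k]
    · obtain ⟨j, rfl⟩ : ∃ j, k = (M - i) + j := ⟨k - (M - i), by omega⟩
      rw [← hdl, traj_append_right, hdl, Zd.rerootRaw_of_lt (by omega), traj_take w (by omega : j ≤ i),
        show i + (M - i + j) - M = j by omega, hE]
      abel
  · rw [traj_of_le _ (by rw [List.length_rotate, hl]; omega), wEnd_rotate,
      Zd.reroot_of_ge (traj_zero w) hi hk.le, ← hl, traj_length]

/-- **Rotations of an even all-turn bridge word are all-turn** (the wrap junction is vertical → `+e₁`).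
[cite: MadrasSlade1993, §3.2 (proof of Theorem 3.2.4), inside the all-turn class] -/
theorem wturns_rotate_of_bridge {M i : ℕ} {w : List Step} (hw : w ∈ allTurnWords M) (hev : Even M)
    (hb : Zd.IsBridge M (traj w)) (hi : i ≤ M) : wturns (w.rotate i) = M - 1 := by
  have hl := (mem_allTurnWords.1 hw).1
  rcases Nat.eq_zero_or_pos M with rfl | hM
  · rw [List.eq_nil_of_length_eq_zero hl]; rfl
  have hlen : (w.rotate i).length = M := by rw [List.length_rotate, hl]
  rw [← hlen]
  refine allTurn_of_consec_ne _ fun k hk => ?_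
  rw [hlen] at hk
  rw [List.getElem_rotate, List.getElem_rotate]
  simp only [hl]
  have hall := consec_ne_of_allTurn w (by rw [hl]; exact (mem_allTurnWords.1 hw).2.2)
  by_cases hwrap : (k + i) % M = M - 1
  · -- the wrap: letters `w[M-1]` (vertical) and `w[0] = +e₁`
    have h2 : (k + 1 + i) % M = 0 := by
      have : k + 1 + i = (k + i) + 1 := by ring
      rw [this, Nat.add_mod, hwrap]
      rcases Nat.eq_zero_or_pos (M - 1) with h0 | h0
      · have : M = 1 := by omega
        subst this; simp
      · rw [Nat.mod_eq_of_lt (by omega : 1 < M), show M - 1 + 1 = M by omega, Nat.mod_self]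
    simp only [hwrap, h2]
    have hv := typ_getLast_of_even hw hM hev hb
    have h0 : w[0]'(by omega) = 0 := getElem_zero_of_isBridge (by omega) (hl.symm ▸ hb)
    refine Step.ne_of_typ_ne ?_
    rw [hv, h0]; decide
  · have hlt : (k + i) % M < M - 1 := by
      have := Nat.mod_lt (k + i) hM; omega
    have h2 : (k + 1 + i) % M = (k + i) % M + 1 := by
      have : k + 1 + i = (k + i) + 1 := by ring
      rw [this, Nat.add_mod, Nat.mod_eq_of_lt (by omega : 1 < M) , Nat.mod_eq_of_lt (by omega)]
    simp only [h2]
    exact hall _ (by rw [hl]; omega)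

/-! ### Appending a separated word keeps self-avoidance -/

/-- **Separation lemma**: if a functional `f` is `≤ c` on the vertices of `u` and `> c` on the (translated)
vertices of `v` after time `1`, then `u ++ v` is self-avoiding when `u` and `v` are. [cite: MadrasSlade1993, §1.2 (concatenation of walks in disjoint half-spaces)] -/
theorem isSAW_append_of_sep {u v : List Step} (hu : IsSAW u) (hv : IsSAW v) (f : Site 2 → ℤ) (c : ℤ)
    (h1 : ∀ i, i ≤ u.length → f (traj u i) ≤ c)
    (h2 : ∀ j, 1 ≤ j → j ≤ v.length → c < f (wEnd u + traj v j)) : IsSAW (u ++ v) := by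
  rw [isSAW_iff_injOn] at hu hv ⊢
  intro i hi j hj hij
  simp only [Set.mem_setOf_eq, List.length_append] at hi hj
  rcases le_or_gt i u.length with hiu | hiu <;> rcases le_or_gt j u.length with hju | hju
  · rw [traj_append_left u v hiu, traj_append_left u v hju] at hij
    exact hu hiu hju hij
  · exfalso
    obtain ⟨j', rfl⟩ : ∃ j', j = u.length + j' := ⟨j - u.length, by omega⟩
    rw [traj_append_left u v hiu, traj_append_right] at hij
    have a1 := h1 i hiu
    have a2 := h2 j' (by omega) (by omega)
    rw [← hij] at a2
    omega
  · exfalso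
    obtain ⟨i', rfl⟩ : ∃ i', i = u.length + i' := ⟨i - u.length, by omega⟩
    rw [traj_append_left u v hju, traj_append_right] at hij
    have a1 := h1 j hju
    have a2 := h2 i' (by omega) (by omega)
    rw [hij] at a2
    omega
  · obtain ⟨i', rfl⟩ : ∃ i', i = u.length + i' := ⟨i - u.length, by omega⟩
    obtain ⟨j', rfl⟩ : ∃ j', j = u.length + j' := ⟨j - u.length, by omega⟩
    rw [traj_append_right, traj_append_right, add_right_inj] at hij
    rw [hv (show i' ∈ {k | k ≤ v.length} by simp; omega) (show j' ∈ {k | k ≤ v.length} by simp; omega) hij]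

/-! ### The `(+e₁, ±e₂)` extension of an even all-turn bridge -/

/-- `dx 0 = 1`. [folklore] -/
private theorem dx_zero : Step.dx 0 = 1 := by decide
/-- `dx 1 = 0`. [folklore] -/
private theorem dx_one : Step.dx 1 = 0 := by decide
/-- `dx 3 = 0`. [folklore] -/
private theorem dx_three : Step.dx 3 = 0 := by decide
/-- `dy 0 = 0`. [folklore] -/
private theorem dy_zero : Step.dy 0 = 0 := by decide
/-- `dy 1 = 1`. [folklore] -/
private theorem dy_one : Step.dy 1 = 1 := by decide
/-- `dy 3 = -1`. [folklore] -/
private theorem dy_three : Step.dy 3 = -1 := by decide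


/-- The vertical letter pointing AWAY from the `x`-axis at the endpoint of `w` (`+e₂` if the endpoint has second
coordinate `≥ 0`, else `−e₂`). [cite: MadrasSlade1993, §3.2 (proof of Theorem 3.2.4), all-turn edition] -/
def extLetter (w : List Step) : Step := if 0 ≤ wEnd w 1 then 1 else 3

/-- **The extension** `w ↦ w · (+e₁) · (±e₂)`. [cite: MadrasSlade1993, §3.2 (proof of Theorem 3.2.4), all-turn edition] -/
def extendAT (w : List Step) : List Step := w ++ [0, extLetter w]

/-- `|extendAT w| = |w| + 2`. [cite: MadrasSlade1993, §1.1 (step words; elementary bookkeeping)] -/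
@[simp] theorem length_extendAT (w : List Step) : (extendAT w).length = w.length + 2 := by
  simp [extendAT]

/-- The extension is injective (the original word is its prefix). [cite: MadrasSlade1993, §1.1 (step words; elementary bookkeeping)] -/
theorem extendAT_injective : Function.Injective extendAT := by
  intro w w' h
  have hl : w.length = w'.length := by
    have := congrArg List.length h; simp at this; exact this
  have := congrArg (List.take w.length) h
  simpa [extendAT, List.take_append_of_le_length le_rfl, hl] using this

/-- `extLetter w ∈ {+e₂, −e₂}`. [cite: MadrasSlade1993, §1.1 (step words; elementary bookkeeping)] -/
theorem extLetter_eq (w : List Step) : extLetter w = 1 ∨ extLetter w = 3 := by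
  unfold extLetter; split_ifs <;> simp

/-- The endpoint of the extension: `x + e₁ ± e₂`. [cite: MadrasSlade1993, §1.1 (step words; elementary bookkeeping)] -/
theorem wEnd_extendAT (w : List Step) :
    wEnd (extendAT w) = wEnd w + Step.vec 0 + Step.vec (extLetter w) := by
  simp [extendAT, wEnd_append, add_assoc]

/-- The extended endpoint is OFF the `x`-axis: its second coordinate is `≠ 0`. [cite: MadrasSlade1993, §3.2, all-turn edition] -/
theorem wEnd_extendAT_apply_one_ne_zero (w : List Step) : wEnd (extendAT w) 1 ≠ 0 := by
  rw [wEnd_extendAT, Pi.add_apply, Pi.add_apply, Step.vec_apply_one, Step.vec_apply_one, dy_zero]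
  unfold extLetter
  split_ifs with h
  · rw [dy_one]; omega
  · rw [dy_three]; omega

/-- The extended endpoint's first coordinate is `x₀ + 1`. [cite: MadrasSlade1993, §1.1 (step words; elementary bookkeeping)] -/
theorem wEnd_extendAT_apply_zero (w : List Step) : wEnd (extendAT w) 0 = wEnd w 0 + 1 := by
  rw [wEnd_extendAT, Pi.add_apply, Pi.add_apply, Step.vec_apply_zero, Step.vec_apply_zero, dx_zero]
  rcases extLetter_eq w with h | h
  · rw [h, dx_one]; ring
  · rw [h, dx_three]; ring

/-- Letters of the extension: the old letters. [cite: MadrasSlade1993, §1.1 (step words; elementary bookkeeping)] -/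
theorem getElem_extendAT_of_lt (w : List Step) {i : ℕ} (hi : i < w.length) {h : i < (extendAT w).length} :
    (extendAT w)[i]'h = w[i] := by
  show (w ++ [0, extLetter w])[i]'(by simpa [extendAT] using h) = w[i]
  exact List.getElem_append_left hi

/-- Letters of the extension: the `+e₁`. [cite: MadrasSlade1993, §1.1 (step words; elementary bookkeeping)] -/
theorem getElem_extendAT_of_eq (w : List Step) {i : ℕ} (hi : i = w.length) {h : i < (extendAT w).length} :
    (extendAT w)[i]'h = 0 := by
  subst hi
  show (w ++ [0, extLetter w])[w.length]'(by simp) = 0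
  rw [List.getElem_append_right (le_refl _)]
  simp

/-- Letters of the extension: the final `±e₂`. [cite: MadrasSlade1993, §1.1 (step words; elementary bookkeeping)] -/
theorem getElem_extendAT_of_eq_succ (w : List Step) {i : ℕ} (hi : i = w.length + 1)
    {h : i < (extendAT w).length} : (extendAT w)[i]'h = extLetter w := by
  subst hi
  show (w ++ [0, extLetter w])[w.length + 1]'(by simp) = extLetter w
  rw [List.getElem_append_right (by omega)]
  simp

/-- The trajectory of the two appended steps. [folklore] -/
private theorem traj_tail_one (s : Step) : traj [0, s] 1 = Step.vec 0 := by
  rw [traj_succ _ (by simp), traj_zero, zero_add]; rfl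

/-- The two appended steps end at `e₁ + e_s`. [folklore] -/
private theorem traj_tail_two (s : Step) : traj [0, s] 2 = Step.vec 0 + Step.vec s := by
  rw [show traj [0, s] 2 = wEnd [0, s] from traj_length _]; simp

/-- **The extension of an even all-turn bridge word is an all-turn bridge word** of length `M + 2`.
[cite: MadrasSlade1993, §3.2 (proof of Theorem 3.2.4), all-turn edition] -/
theorem extendAT_mem_allTurnWords {M : ℕ} {w : List Step} (hw : w ∈ allTurnWords M) (hM : 0 < M) (hev : Even M)
    (hb : Zd.IsBridge M (traj w)) : extendAT w ∈ allTurnWords (M + 2) ∧ Zd.IsBridge (M + 2) (traj (extendAT w)) := by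
  obtain ⟨hl, hs, ht⟩ := mem_allTurnWords.1 hw
  have hX : 0 < wEnd w 0 := by
    have := (hb M (by omega) le_rfl).1
    rwa [traj_zero, ← hl, traj_length] at this
  have htail1 : (wEnd w + traj [0, extLetter w] 1) 0 = wEnd w 0 + 1 := by
    rw [traj_tail_one, Pi.add_apply, Step.vec_apply_zero, dx_zero]
  have htail2 : (wEnd w + traj [0, extLetter w] 2) 0 = wEnd w 0 + 1 := by
    rw [traj_tail_two, Pi.add_apply, Pi.add_apply, Step.vec_apply_zero, Step.vec_apply_zero, dx_zero]
    rcases extLetter_eq w with h | h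
    · rw [h, dx_one]; ring
    · rw [h, dx_three]; ring
  -- self-avoidance by `x`-separation
  have hsaw : IsSAW (extendAT w) := by
    refine isSAW_append_of_sep hs (by rcases extLetter_eq w with h | h <;> rw [h] <;> decide)
      (fun z => z 0) (wEnd w 0) (fun i hi => ?_) (fun j hj1 hj2 => ?_)
    · rcases Nat.eq_zero_or_pos i with rfl | hi0
      · rw [traj_zero]; exact hX.le
      · have := (hb i hi0 (by omega)).2
        rwa [← hl, traj_length] at this
    · simp only [List.length_cons, List.length_nil] at hj2
      have hj : j = 1 ∨ j = 2 := by omega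
      rcases hj with rfl | rfl
      · rw [htail1]; omega
      · rw [htail2]; omega
  refine ⟨mem_allTurnWords.2 ⟨by simp [hl], hsaw, ?_⟩, ?_⟩
  · -- all-turn: inside `w`, at the seam (vertical → `+e₁`), and `+e₁ → ±e₂`
    have h := allTurn_of_consec_ne (extendAT w) fun i hi => ?_
    · simpa [hl] using h
    simp only [length_extendAT, hl] at hi
    have hall := consec_ne_of_allTurn w (by rw [hl]; exact ht)
    by_cases h1 : i + 1 < M
    · rw [getElem_extendAT_of_lt w (by omega), getElem_extendAT_of_lt w (by omega)]
      exact hall i (by omega)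
    · by_cases h2 : i + 1 = M
      · rw [getElem_extendAT_of_lt w (by omega), getElem_extendAT_of_eq w (by omega)]
        have hv := typ_getLast_of_even hw hM hev hb
        have hi' : i = M - 1 := by omega
        subst hi'
        exact Step.ne_of_typ_ne (by rw [hv]; decide)
      · rw [getElem_extendAT_of_eq w (by omega), getElem_extendAT_of_eq_succ w (by omega)]
        rcases extLetter_eq w with h | h <;> rw [h] <;> decide
  · -- bridge
    intro k hk1 hk2
    have hend : traj (extendAT w) (M + 2) 0 = wEnd w 0 + 1 := by
      rw [show M + 2 = (extendAT w).length by simp [hl], traj_length, wEnd_extendAT_apply_zero]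
    rw [traj_zero, hend]
    simp only [Pi.zero_apply]
    rcases le_or_gt k M with hkM | hkM
    · have e : traj (extendAT w) k = traj w k := traj_append_left _ _ (by omega)
      rw [e]
      have := hb k hk1 hkM
      rw [traj_zero, ← hl, traj_length] at this
      simp only [Pi.zero_apply] at this
      omega
    · obtain ⟨j, rfl⟩ : ∃ j, k = M + j := ⟨k - M, by omega⟩
      have e : traj (extendAT w) (M + j) = wEnd w + traj [0, extLetter w] j := by
        rw [← hl]; exact traj_append_right _ _ _
      rw [e]
      have hj : j = 1 ∨ j = 2 := by omega
      rcases hj with rfl | rfl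
      · rw [htail1]; omega
      · rw [htail2]; omega

end Literature.Probability.RandomPlanarGeometry.SAW

end
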